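import Literature.NumberTheory.QuadraticFields.FundamentalDiscriminant
import Mathlib.RingTheory.Ideal.Norm.AbsNorm
import Mathlib.LinearAlgebra.FreeModule.PID
import HarnessLib

/-!
# Quadratic fields: the integral basis `(1, τ)` with `τ² = ετ + m`, `ε ∈ {0,1}`, the conjugation, and norms

Topic `NumberTheory/QuadraticFields`, namespace `Literature.NumberTheory.QuadraticFields.Quadratic`
(continuing `HeegnerCondition.lean`: basis `(1, ω)` of `𝓞 K`, `d_K = t² + 4m`;
`SquareRootGenerator.lean`: the conjugation `a + bθ ↦ a − bθ`; `FundamentalDiscriminant.lean`: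
`d_K` is fundamental). The normal form used by Bhargava (HCL I §3; Bhargava–Varma §2.1:
"Write `𝒪 = ℤ + ℤτ` where … `τ² = ετ + (D − ε)/4`, `ε ∈ {0, 1}` in accordance with whether
`D ≡ 0` or `1 (mod 4)`") for the maximal order of a quadratic field `K` of discriminant `D = d_K`,
packaged for the parametrization files `CubicFields/ThreeTorsionParametrization*.lean`:

* `TauData K` — a `ℤ`-basis `(1, τ)` of `𝓞 K` with `τ² = ετ + m`, `ε ∈ {0, 1}` (a structure; it
  exists for every quadratic field, `nonempty_tauData`, by shifting the `ω` of `HeegnerCondition`);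
  then `s = 2τ − ε` has `s² = d_K = ε + 4m` (`sq_s`, `discr_eq`), `τ = (ε + s)/2` (`coe_τ`), and
  every algebraic integer is `u + vτ` (`exists_int_coords`);
* `not_isSquare_discr` — `d_K` is not a square (fundamental discriminants are not);
* `TauData.σ` — **the conjugation** of `K` (the tree's `Quadratic.conj` at the generator `s`),
  with `σ s = −s`, `σ τ = ε − τ`, `σ ∘ σ = id`;
* `TauData.coe_norm` — **`N(x) = x · σx`** for `x ∈ 𝓞 K` (Mathlib's `Algebra.norm ℤ`, computed on
  the basis `(1, τ)`: `N(u + vτ) = u² + εuv − mv²`);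
* `TauData.exists_basis_of_ideal` — every nonzero ideal `I ⊆ 𝓞 K` has a `ℤ`-basis `(α, β)`
  (Mathlib's `Ideal.selfBasis`), and **`N(I) · s = ±(α σβ − σα β)`** (the oriented index:
  Mathlib's `Ideal.natAbs_det_basis_change`).

Everything is proved; no named facts.

## References

* M. Bhargava, I. Varma, Proc. LMS 112 (2016) = arXiv:1401.5875, §2.1 (the oriented quadratic
  ring `ℤ + ℤτ`) [BhargavaVarma2016].
* D. A. Marcus, *Number Fields*, 2nd ed. (2018), Ch. 2, Thm. 1 [Marcus2018].
-/

noncomputable section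

open scoped Classical

open Module NumberField

namespace Literature.NumberTheory.QuadraticFields.Quadratic

variable {K : Type*} [Field K] [NumberField K]

/-! ### Fundamental discriminants are not squares -/

omit [NumberField K] in
/-- A fundamental discriminant is not a perfect square (`d ≡ 1 (mod 4)` squarefree `≠ 1`, or
`d = 4m` with `m ≡ 2, 3 (mod 4)` squarefree). [folklore] -/
theorem not_isSquare_of_isFundamental {d : ℤ}
    (hd : (d % 4 = 1 ∧ Squarefree d ∧ d ≠ 1) ∨
      (4 ∣ d ∧ (d / 4 % 4 = 2 ∨ d / 4 % 4 = 3) ∧ Squarefree (d / 4))) : ¬ IsSquare d := by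
  rintro ⟨r, hr⟩
  rcases hd with ⟨-, hsq, h1⟩ | ⟨h4, hm, hsq⟩
  · have hu : IsUnit r := hsq r ⟨1, by rw [hr, mul_one]⟩
    rcases Int.isUnit_iff.mp hu with rfl | rfl <;> norm_num at hr <;> exact h1 hr
  · obtain ⟨k, rfl | rfl⟩ := Int.even_or_odd' r
    · have hd4 : d = 4 * (k * k) := by rw [hr]; ring
      have hk : d / 4 = k * k := by omega
      have hu : IsUnit k := hsq k ⟨1, by rw [hk, mul_one]⟩
      rcases Int.isUnit_iff.mp hu with rfl | rfl <;> norm_num at hk <;> omega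
    · have hd4 : d = 4 * (k * k + k) + 1 := by rw [hr]; ring
      omega

/-- **`d_K` is not a square** for a quadratic field `K`. [folklore] -/
theorem not_isSquare_discr (h2 : finrank ℚ K = 2) : ¬ IsSquare (NumberField.discr K) :=
  not_isSquare_of_isFundamental (isFundamentalDiscriminant_discr h2)

/-! ### The basis `(1, τ)`, `τ² = ετ + m` -/

variable (K) in
/-- **Bhargava's normal form of the maximal order of a quadratic field**: a `ℤ`-basis `(1, τ)` of
`𝓞 K` with `τ² = ετ + m`, `ε ∈ {0, 1}` (so that `d_K = ε + 4m ≡ ε (mod 4)` and `τ = (ε + √d_K)/2`;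
Bhargava–Varma §2.1, HCL I §3). [cite: BhargavaVarma2016, §2.1 (the oriented quadratic ring ℤ + ℤτ, τ² = ετ + (D − ε)/4)] -/
structure TauData where
  /-- the generator `τ` -/
  τ : 𝓞 K
  /-- `ε ∈ {0, 1}`, `≡ d_K (mod 4)` -/
  ε : ℤ
  /-- `m = (d_K − ε)/4` -/
  m : ℤ
  /-- the `ℤ`-basis `(1, τ)` of `𝓞 K` -/
  basis : Basis (Fin 2) ℤ (𝓞 K)
  basis_zero : basis 0 = 1
  basis_one : basis 1 = τ
  ε_eq : ε = 0 ∨ ε = 1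
  τ_sq : τ * τ = (m : 𝓞 K) + (ε : 𝓞 K) * τ

/-- **Existence**: every quadratic field admits such a basis (shift the `ω` of a basis `(1, ω)`,
`ω² = m₀ + tω`, by `⌊t/2⌋`). [folklore] -/
theorem nonempty_tauData (h2 : finrank ℚ K = 2) : Nonempty (TauData K) := by
  obtain ⟨b, hb⟩ := exists_basis_zero_eq_one h2
  set ω := b 1 with hω
  set m₀ : ℤ := b.repr (ω * ω) 0 with hm₀
  set t : ℤ := b.repr (ω * ω) 1 with ht
  have hωω : ω * ω = (m₀ : 𝓞 K) + (t : 𝓞 K) * ω := basis_one_mul_self_eq b hb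
  set k : ℤ := t / 2 with hk
  set ε : ℤ := t % 2 with hε
  have htk : t = 2 * k + ε := by omega
  have hε01 : ε = 0 ∨ ε = 1 := by omega
  set τ : 𝓞 K := ω - (k : 𝓞 K) with hτ
  -- the new basis `(1, τ)`
  have hli : LinearIndependent ℤ ![(1 : 𝓞 K), τ] := by
    rw [LinearIndependent.pair_iff]
    intro u v huv
    have h1 : (u - v * k) • b 0 + v • b 1 = 0 := by
      rw [hb, ← hω]
      simp only [zsmul_eq_mul, hτ] at huv ⊢
      push_cast
      linear_combination huv
    have hli0 := b.linearIndependent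
    rw [Fintype.linearIndependent_iff] at hli0
    have := hli0 ![u - v * k, v] (by
      rw [Fin.sum_univ_two]
      simpa using h1)
    have hv : v = 0 := by simpa using this 1
    have hu : u - v * k = 0 := by simpa using this 0
    exact ⟨by rw [hv, zero_mul, sub_zero] at hu; exact hu, hv⟩
  have hsp : ⊤ ≤ Submodule.span ℤ (Set.range ![(1 : 𝓞 K), τ]) := by
    intro x _
    have hx : x = (b.repr x 0 : 𝓞 K) + (b.repr x 1 : 𝓞 K) * ω := by
      conv_lhs => rw [← b.sum_repr x]
      rw [Fin.sum_univ_two, hb, zsmul_eq_mul, mul_one, zsmul_eq_mul]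
    have hx' : x = (b.repr x 0 + b.repr x 1 * k : ℤ) • (1 : 𝓞 K) + (b.repr x 1) • τ := by
      rw [zsmul_eq_mul, zsmul_eq_mul, mul_one, hτ]
      push_cast
      linear_combination hx
    rw [hx']
    refine Submodule.add_mem _ (Submodule.smul_mem _ _ (Submodule.subset_span ⟨0, rfl⟩))
      (Submodule.smul_mem _ _ (Submodule.subset_span ⟨1, rfl⟩))
  let b' : Basis (Fin 2) ℤ (𝓞 K) := Basis.mk hli hsp
  have htkc : (t : 𝓞 K) = 2 * (k : 𝓞 K) + (ε : 𝓞 K) := by exact_mod_cast htk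
  have key : (ω - (k : 𝓞 K)) * (ω - (k : 𝓞 K))
      = ((m₀ + k ^ 2 + ε * k : ℤ) : 𝓞 K) + (ε : 𝓞 K) * (ω - (k : 𝓞 K)) := by
    push_cast
    linear_combination hωω + ω * htkc
  exact ⟨⟨τ, ε, m₀ + k ^ 2 + ε * k, b', by simp [b'], by simp [b'], hε01, key⟩⟩

namespace TauData

variable (T : TauData K)

omit [NumberField K] in
/-- `ε² = ε`. [folklore] -/
theorem ε_sq : T.ε ^ 2 = T.ε := by
  rcases T.ε_eq with h | h <;> simp [h]

/-- The square-root generator `s = 2τ − ε ∈ 𝓞 K` (`= √d_K`). [folklore] -/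
def s : 𝓞 K := 2 * T.τ - (T.ε : 𝓞 K)

/-- `s² = ε + 4m` in `𝓞 K`. [folklore] -/
theorem s_mul_s : T.s * T.s = (T.ε : 𝓞 K) + 4 * (T.m : 𝓞 K) := by
  have hε2 : (T.ε : 𝓞 K) ^ 2 = (T.ε : 𝓞 K) := by exact_mod_cast T.ε_sq
  simp only [s]
  linear_combination 4 * T.τ_sq + hε2

/-- **`d_K = ε + 4m`** (the trace form on `(1, τ)`; `HeegnerCondition.discr_eq_sq_add_four_mul`).
[folklore] -/
theorem discr_eq : NumberField.discr K = T.ε + 4 * T.m := by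
  have h := discr_eq_sq_add_four_mul T.basis T.basis_zero
  have hrepr : T.basis.repr (T.basis 1 * T.basis 1) = Finsupp.equivFunOnFinite.symm ![T.m, T.ε] := by
    have : T.basis 1 * T.basis 1 = T.m • T.basis 0 + T.ε • T.basis 1 := by
      rw [T.basis_one, T.basis_zero, zsmul_eq_mul, zsmul_eq_mul, mul_one]
      exact T.τ_sq
    rw [this, map_add, map_zsmul, map_zsmul, T.basis.repr_self, T.basis.repr_self]
    ext i
    fin_cases i <;> simp
  rw [hrepr] at h
  simp only [Finsupp.coe_equivFunOnFinite_symm, Matrix.cons_val_one, Matrix.cons_val_zero] at h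
  rw [h, T.ε_sq]

/-- `4 ∣ d_K − ε`. [folklore] -/
theorem four_dvd_discr_sub : (4 : ℤ) ∣ NumberField.discr K - T.ε := by
  have := T.discr_eq
  exact ⟨T.m, by omega⟩

/-- **`s² = d_K`** in `K`. [folklore] -/
theorem sq_s : ((T.s : 𝓞 K) : K) ^ 2 = (NumberField.discr K : K) := by
  have h := congrArg (algebraMap (𝓞 K) K) T.s_mul_s
  simp only [map_mul, map_add, map_intCast, map_ofNat] at h
  rw [← RingOfIntegers.coe_eq_algebraMap] at h
  rw [T.discr_eq, sq]
  push_cast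
  linear_combination h

/-- `τ = (ε + s)/2` in `K`. [folklore] -/
theorem coe_τ : ((T.τ : 𝓞 K) : K) = ((T.ε : K) + (T.s : K)) / 2 := by
  simp only [s, map_sub, map_mul, map_ofNat, map_intCast]
  ring

omit [NumberField K] in
/-- **Every algebraic integer is `u + vτ`** with `u, v ∈ ℤ`. [folklore] -/
theorem exists_int_coords (x : 𝓞 K) : ∃ u v : ℤ, x = (u : 𝓞 K) + (v : 𝓞 K) * T.τ := by
  refine ⟨T.basis.repr x 0, T.basis.repr x 1, ?_⟩
  conv_lhs => rw [← T.basis.sum_repr x]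
  rw [Fin.sum_univ_two, T.basis_zero, T.basis_one, zsmul_eq_mul, mul_one, zsmul_eq_mul]

/-- The coordinates in `K`: `x = u + v (ε + s)/2`. [folklore] -/
theorem exists_int_coords_coe (x : 𝓞 K) :
    ∃ u v : ℤ, (x : K) = u + v * (((T.ε : K) + (T.s : K)) / 2) := by
  obtain ⟨u, v, h⟩ := T.exists_int_coords x
  refine ⟨u, v, ?_⟩
  rw [h, ← T.coe_τ]
  simp

/-! ### The conjugation -/

/-- `s ∉ ℚ` (as `d_K` is not a square). [folklore] -/
theorem s_not_mem_range (h2 : finrank ℚ K = 2) : ((T.s : 𝓞 K) : K) ∉ Set.range (algebraMap ℚ K) := by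
  rintro ⟨q, hq⟩
  apply not_isSquare_discr (K := K) h2
  have hq2 : (algebraMap ℚ K) (q ^ 2) = (algebraMap ℚ K) (NumberField.discr K : ℚ) := by
    rw [map_pow, hq, T.sq_s]; simp
  have hq2' : q ^ 2 = (NumberField.discr K : ℚ) := (algebraMap ℚ K).injective hq2
  exact Rat.isSquare_intCast_iff.mp ⟨q, by rw [← hq2', sq]⟩

/-- `s² = d_K` with `d_K` viewed in `ℚ`. [folklore] -/
theorem sq_s_algebraMap : ((T.s : 𝓞 K) : K) ^ 2 = algebraMap ℚ K (NumberField.discr K : ℚ) := by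
  rw [T.sq_s]; simp

/-- **The conjugation `σ` of the quadratic field `K`** (`u + v s ↦ u − v s`; the tree's
`Quadratic.conj` at the generator `s = √d_K`), as a ring endomorphism. [folklore] -/
def σ (h2 : finrank ℚ K = 2) : K →+* K :=
  (conj h2 (T.s_not_mem_range h2) T.sq_s_algebraMap).toRingHom

/-- `σ s = −s`. [folklore] -/
theorem σ_s (h2 : finrank ℚ K = 2) : T.σ h2 (T.s : K) = -(T.s : K) :=
  conj_gen h2 (T.s_not_mem_range h2) T.sq_s_algebraMap

/-- `σ` fixes `ℚ`. [folklore] -/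
theorem σ_ratCast (h2 : finrank ℚ K = 2) (q : ℚ) : T.σ h2 (q : K) = q := by
  have h := conj_algebraMap h2 (T.s_not_mem_range h2) T.sq_s_algebraMap q
  simp only [eq_ratCast] at h
  exact h

/-- `σ ∘ σ = id`. [folklore] -/
theorem σ_σ (h2 : finrank ℚ K = 2) (x : K) : T.σ h2 (T.σ h2 x) = x :=
  conj_conj h2 (T.s_not_mem_range h2) T.sq_s_algebraMap x

/-- `σ τ = ε − τ`. [folklore] -/
theorem σ_τ (h2 : finrank ℚ K = 2) : T.σ h2 (T.τ : K) = (T.ε : K) - (T.τ : K) := by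
  rw [T.coe_τ, map_div₀, map_add, map_intCast, map_ofNat, T.σ_s]
  ring

/-- `σ (u + vτ) = u + v(ε − τ)`: the conjugate of an algebraic integer in coordinates. [folklore] -/
theorem σ_coe_of_coords (h2 : finrank ℚ K = 2) {x : 𝓞 K} {u v : ℤ}
    (h : x = (u : 𝓞 K) + (v : 𝓞 K) * T.τ) :
    T.σ h2 (x : K) = (u : K) + (v : K) * ((T.ε : K) - (T.τ : K)) := by
  rw [h]
  simp only [map_add, map_mul, map_intCast, T.σ_τ]

/-! ### Norms -/

/-- **`N(x) = x · σx`** for `x ∈ 𝓞 K`: Mathlib's `Algebra.norm ℤ x`, the determinant of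
multiplication by `x = u + vτ` on `(1, τ)`, is `u² + εuv − mv² = (u + vτ)(u + v(ε − τ))`.
[folklore] -/
theorem coe_norm (h2 : finrank ℚ K = 2) (x : 𝓞 K) :
    ((Algebra.norm ℤ x : ℤ) : K) = (x : K) * T.σ h2 (x : K) := by
  obtain ⟨u, v, hx⟩ := T.exists_int_coords x
  have hdet : Algebra.norm ℤ x = u * (u + T.ε * v) - (v * T.m) * v := by
    rw [Algebra.norm_eq_matrix_det T.basis, Matrix.det_fin_two, Algebra.leftMulMatrix_eq_repr_mul,
      Algebra.leftMulMatrix_eq_repr_mul, Algebra.leftMulMatrix_eq_repr_mul,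
      Algebra.leftMulMatrix_eq_repr_mul, T.basis_zero, T.basis_one, mul_one]
    have hx0 : x = u • T.basis 0 + v • T.basis 1 := by
      rw [T.basis_zero, T.basis_one, zsmul_eq_mul, zsmul_eq_mul, mul_one]; exact hx
    have hxτ : x * T.τ = (v * T.m) • T.basis 0 + (u + T.ε * v) • T.basis 1 := by
      rw [T.basis_zero, T.basis_one, zsmul_eq_mul, zsmul_eq_mul, mul_one, hx]
      push_cast
      linear_combination (v : 𝓞 K) * T.τ_sq
    have r0 : T.basis.repr x = Finsupp.equivFunOnFinite.symm ![u, v] := by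
      rw [hx0, map_add, map_zsmul, map_zsmul, T.basis.repr_self, T.basis.repr_self]
      ext i; fin_cases i <;> simp
    have r1 : T.basis.repr (x * T.τ) = Finsupp.equivFunOnFinite.symm ![v * T.m, u + T.ε * v] := by
      rw [hxτ, map_add, map_zsmul, map_zsmul, T.basis.repr_self, T.basis.repr_self]
      ext i; fin_cases i <;> simp
    rw [r0, r1]
    simp
  have hxK : (x : K) = (u : K) + (v : K) * (T.τ : K) := by
    have := congrArg (algebraMap (𝓞 K) K) hx
    simp only [map_add, map_mul, map_intCast] at this
    rw [← RingOfIntegers.coe_eq_algebraMap, ← RingOfIntegers.coe_eq_algebraMap] at this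
    exact this
  rw [hdet, T.σ_coe_of_coords h2 hx, hxK]
  have hτK : ((T.τ : 𝓞 K) : K) * ((T.ε : K) - (T.τ : K)) = -(T.m : K) := by
    have := congrArg (algebraMap (𝓞 K) K) T.τ_sq
    simp only [map_mul, map_add, map_intCast] at this
    rw [← RingOfIntegers.coe_eq_algebraMap] at this
    linear_combination -this
  push_cast
  linear_combination (-(v : K) ^ 2) * hτK

/-- **A `ℤ`-basis of a nonzero ideal and its oriented index**: every ideal `I ≠ 0` of `𝓞 K` has
elements `α, β` with `I = ℤα ⊕ ℤβ`, and `N(I) · s = ±(α σβ − σα β)` (Mathlib: `Ideal.selfBasis`,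
`Ideal.natAbs_det_basis_change`; the determinant of `(α, β)` on `(1, τ)` is `α₁β₂ − α₂β₁`, and
`α σβ − σα β = −(α₁β₂ − α₂β₁) s`). [folklore] -/
theorem exists_basis_of_ideal (h2 : finrank ℚ K = 2) (I : Ideal (𝓞 K)) (hI : I ≠ ⊥) :
    ∃ α β : 𝓞 K, α ∈ I ∧ β ∈ I ∧ (∀ x ∈ I, ∃ u v : ℤ, x = (u : 𝓞 K) * α + (v : 𝓞 K) * β) ∧
      (∀ u v : ℤ, (u : 𝓞 K) * α + (v : 𝓞 K) * β = 0 → u = 0 ∧ v = 0) ∧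
      (((Ideal.absNorm I : ℕ) : K) * (T.s : K) = (α : K) * T.σ h2 (β : K) - T.σ h2 (α : K) * (β : K) ∨
        ((Ideal.absNorm I : ℕ) : K) * (T.s : K) = -((α : K) * T.σ h2 (β : K) - T.σ h2 (α : K) * (β : K))) := by
  set bI := Ideal.selfBasis T.basis I hI with hbI
  set α : 𝓞 K := (bI 0).1 with hα
  set β : 𝓞 K := (bI 1).1 with hβ
  refine ⟨α, β, (bI 0).2, (bI 1).2, ?_, ?_, ?_⟩
  · intro x hx
    set y : I := ⟨x, hx⟩ with hy
    refine ⟨bI.repr y 0, bI.repr y 1, ?_⟩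
    have hsum := bI.sum_repr y
    rw [Fin.sum_univ_two] at hsum
    have hval := congrArg Subtype.val hsum
    simp only [Submodule.coe_add, Submodule.coe_smul_of_tower, zsmul_eq_mul] at hval
    rw [show x = (y : 𝓞 K) from rfl, ← hval]
  · intro u v huv
    have hli := Fintype.linearIndependent_iff.mp bI.linearIndependent ![u, v] (by
      rw [Fin.sum_univ_two]
      apply Subtype.ext
      simp only [Matrix.cons_val_zero, Matrix.cons_val_one, Submodule.coe_add,
        Submodule.coe_smul_of_tower, zsmul_eq_mul, Submodule.coe_zero]
      exact huv)
    exact ⟨by simpa using hli 0, by simpa using hli 1⟩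
  · -- the determinant
    have hdet := Ideal.natAbs_det_basis_change T.basis I bI
    obtain ⟨a1, a2, hαc⟩ := T.exists_int_coords α
    obtain ⟨b1, b2, hβc⟩ := T.exists_int_coords β
    have hd : T.basis.det ((↑) ∘ bI) = a1 * b2 - a2 * b1 := by
      rw [Basis.det_apply, Matrix.det_fin_two]
      have rα : T.basis.repr α = Finsupp.equivFunOnFinite.symm ![a1, a2] := by
        have : α = a1 • T.basis 0 + a2 • T.basis 1 := by
          rw [T.basis_zero, T.basis_one, zsmul_eq_mul, zsmul_eq_mul, mul_one]; exact hαc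
        rw [this, map_add, map_zsmul, map_zsmul, T.basis.repr_self, T.basis.repr_self]
        ext i; fin_cases i <;> simp
      have rβ : T.basis.repr β = Finsupp.equivFunOnFinite.symm ![b1, b2] := by
        have : β = b1 • T.basis 0 + b2 • T.basis 1 := by
          rw [T.basis_zero, T.basis_one, zsmul_eq_mul, zsmul_eq_mul, mul_one]; exact hβc
        rw [this, map_add, map_zsmul, map_zsmul, T.basis.repr_self, T.basis.repr_self]
        ext i; fin_cases i <;> simp
      simp only [Basis.toMatrix_apply, Function.comp_apply]
      rw [show (bI 0).1 = α from rfl, show (bI 1).1 = β from rfl, rα, rβ]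
      simp; ring
    have hK : (α : K) * T.σ h2 (β : K) - T.σ h2 (α : K) * (β : K) = -((a1 * b2 - a2 * b1 : ℤ) : K) * (T.s : K) := by
      rw [T.σ_coe_of_coords h2 hαc, T.σ_coe_of_coords h2 hβc, hαc, hβc]
      push_cast
      rw [T.coe_τ]
      simp only [s, map_sub, map_mul, map_ofNat, map_intCast]
      ring
    rw [hK, ← hdet, hd]
    rcases le_or_gt 0 (a1 * b2 - a2 * b1) with h | h
    · right
      rw [show ((Int.natAbs (a1 * b2 - a2 * b1) : ℕ) : K) = ((a1 * b2 - a2 * b1 : ℤ) : K) by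
        rw [← Int.cast_natCast, Int.natAbs_of_nonneg h]]
      ring
    · left
      rw [show ((Int.natAbs (a1 * b2 - a2 * b1) : ℕ) : K) = -((a1 * b2 - a2 * b1 : ℤ) : K) by
        rw [← Int.cast_natCast, ← Int.cast_neg, Int.ofNat_natAbs_of_nonpos h.le]]

end TauData

end Literature.NumberTheory.QuadraticFields.Quadratic

end
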